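import Summits.Ventures.CertifiedManyBodySolver.Certificates.HubRm2uTierP.Head
import Summits.Ventures.CertifiedManyBodySolver.Certificates.HubRm2uTierP.Hints017
import Summits.Ventures.CertifiedManyBodySolver.Certificates.HubRm2uTierP.Hints018
import Summits.Ventures.CertifiedManyBodySolver.Rows.CorrWindowCertKernelChainQuotAdjFastBox

/-!
# tier-P instance (HubRm2u-R13-W3) — chain forest segment 68 of 96 (steps 226..228 from `[]`), file 1 of 1: steps 226..228 (topology (B): eval%-chained accumulators, import-serial INSIDE the segment only)

Generated by hubbard-algo-p2's untrusted exporter (emit_v0.py + emit_w3.py); every datum below is re-derived / re-checked by the kernel chain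
(`stepEQA`, Rows/CorrWindowCertKernelChainQuotAdj.lean) or is inert. HONEST FRAMING (xx1): instance data / kernel replay of a CONTROL/CALIBRATION
certificate (hub-Rm2-u′, 4^40-dyadic two-level Gram factors); nothing here is a theorem about the Hubbard model; no summit statement. [cite: Han2020Bootstrap, §3]
-/

set_option linter.style.longLine false
set_option maxRecDepth 100000
set_option maxHeartbeats 0

namespace Summit.Ventures.CertifiedManyBodySolver
namespace CARPolyWindow.TierP.HubRm2u
open Summit.Ventures.CertifiedQuantumChemistry Summit.Ventures.CertifiedQuantumChemistry.CARPoly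
open Literature.MathematicalPhysics.QuantumLattice Literature.MathematicalPhysics.QuantumLattice.HubbardWave0
open Literature.Probability.LatticeModels
open CARPolyWindow CARPolyWindow.BoxGeom

/-- segment 68 starts from the EMPTY accumulator before step 226 (chain forest, R-g4-11 (L6)). [folklore] -/
def C68_0 : SOSDual.EncPoly := []

/-- accumulator after step 227 within segment 68 (evaluated at elaboration; the kernel re-derives it in `step_226`). [folklore] -/
def C68_1 : SOSDual.EncPoly := eval% stepEQA D 2048 C68_0 (slices.getD 226 []) (hintsOfCodes Dr reps HC226)

/-- KERNEL FACT, step 226 of 350 (fast step (L7): `stepEQAFB_kernel`, box edition). [folklore] -/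
theorem step_226 : C68_1 = stepEQA D 2048 C68_0 (slices.getD 226 []) (hintsOfCodes Dr reps HC226) :=
  stepEQAFB_kernel 6 13 7 rfl (by decide +kernel)

/-- accumulator after step 228 within segment 68 (evaluated at elaboration; the kernel re-derives it in `step_227`). [folklore] -/
def C68_2 : SOSDual.EncPoly := eval% stepEQA D 2048 C68_1 (slices.getD 227 []) (hintsOfCodes Dr reps HC227)

/-- KERNEL FACT, step 227 of 350 (fast step (L7): `stepEQAFB_kernel`, box edition). [folklore] -/
theorem step_227 : C68_2 = stepEQA D 2048 C68_1 (slices.getD 227 []) (hintsOfCodes Dr reps HC227) :=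
  stepEQAFB_kernel 6 13 7 rfl (by decide +kernel)

/-- accumulator after step 229 within segment 68 (evaluated at elaboration; the kernel re-derives it in `step_228`). [folklore] -/
def C68_3 : SOSDual.EncPoly := eval% stepEQA D 2048 C68_2 (slices.getD 228 []) (hintsOfCodes Dr reps HC228)

/-- KERNEL FACT, step 228 of 350 (fast step (L7): `stepEQAFB_kernel`, box edition). [folklore] -/
theorem step_228 : C68_3 = stepEQA D 2048 C68_2 (slices.getD 228 []) (hintsOfCodes Dr reps HC228) :=
  stepEQAFB_kernel 6 13 7 rfl (by decide +kernel)


end CARPolyWindow.TierP.HubRm2u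
end Summit.Ventures.CertifiedManyBodySolver
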